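import Mathlib
import Literature.Combinatorics.Optimization.BipartiteRegularFactor

/-!
# `DivisionGap.PerMultiplesHard` (stmt-ValiantsHypothesis-5068), line `uncharged-face-walk`:
stub `stub_regularPairFactor` — two-sided mixing + minimum degree give the `f`-factor cut condition

A bipartite host `Y ⊆ Fin n × Fin n` (rows × columns) with the LOWER mixing bound of a
quasi-random graph, `e_Y(A, B) ≥ β #A #B − ε n²` for all row sets `A` and column sets `B`
(`e_Y(A, B) = #{e ∈ Y : e.1 ∈ A, e.2 ∈ B}`), and minimum row/column degree `(β − η) n`, satisfies
the cut condition `f (#A + #B) ≤ f n + e_Y(A, B)` of the bipartite `f`-factor theorem (Ore 1956;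
in the tree: `Literature.Combinatorics.Optimization.exists_regular_subgraph_of_cut_condition`,
wrapped as `RegularFactor.stub_regularFactor`) for every `f ≤ (β − η − √(ε/β)) n`; hence such a
host has an `f`-regular spanning subgraph (`exists_regularFactor_of_mixing`).

Proof.  Put `a = #A`, `b = #B`, `θ = √(ε/β)` (so `β θ² = ε`), `e = e_Y(A, B)`.  If `a + b ≤ n`
there is nothing to prove; otherwise `s = a + b − n > 0`, `s ≤ a`, `s ≤ b`, and we show
`f s ≤ e`.  Three lower bounds for `e` (double counting over columns / rows, and mixing):
`e ≥ b ((β − η) n − (n − a))`, `e ≥ a ((β − η) n − (n − b))`, `e ≥ β a b − ε n²`.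
(i) If `(1 − θ) n < a`, then `(β − η) n − (n − a) > (β − η − θ) n ≥ f`, so `e ≥ b f ≥ s f`.
(ii) `(1 − θ) n < b` is symmetric.  (iii) Otherwise `n − a ≥ θ n` and `n − b ≥ θ n`, so
`(n − a)(n − b) ≥ θ² n²`, i.e. `a b − n s ≥ ε n² / β`, whence
`e ≥ β a b − ε n² ≥ β n s ≥ f s` (`f ≤ β n`).  Elementary; no source beyond the `f`-factor
theorem it feeds. [folklore]
-/

noncomputable section

-- `Summit.ValiantsHypothesis.ValiantsHypothesis.…` is the tree's mandated layout (Sub = Summit).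
set_option linter.dupNamespace false

open Finset
open scoped BigOperators

namespace Summit.ValiantsHypothesis.ValiantsHypothesis.Theorems.DivisionGap.PerMultiplesHard.RegularPairFactor

/-- Double counting over columns: the number of cells of `Y` in the rectangle `A × B` is the sum
over the columns `j ∈ B` of the number of rows `i ∈ A` with `(i, j) ∈ Y`. [folklore] -/
theorem card_filter_rect_eq_sum_cols {n : ℕ} (Y : Finset (Fin n × Fin n))
    (A B : Finset (Fin n)) :
    (Y.filter fun e => e.1 ∈ A ∧ e.2 ∈ B).card =
      ∑ j ∈ B, (A.filter fun i => (i, j) ∈ Y).card := by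
  have h1 : (Y.filter fun e => e.1 ∈ A ∧ e.2 ∈ B) = (A ×ˢ B).filter (fun e => e ∈ Y) := by
    ext e
    simp only [Finset.mem_filter, Finset.mem_product]
    tauto
  rw [h1, Finset.card_filter, Finset.sum_product_right]
  simp only [Finset.card_filter]

/-- Double counting over rows: the number of cells of `Y` in the rectangle `A × B` is the sum
over the rows `i ∈ A` of the number of columns `j ∈ B` with `(i, j) ∈ Y`. [folklore] -/
theorem card_filter_rect_eq_sum_rows {n : ℕ} (Y : Finset (Fin n × Fin n))
    (A B : Finset (Fin n)) :
    (Y.filter fun e => e.1 ∈ A ∧ e.2 ∈ B).card =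
      ∑ i ∈ A, (B.filter fun j => (i, j) ∈ Y).card := by
  have h1 : (Y.filter fun e => e.1 ∈ A ∧ e.2 ∈ B) = (A ×ˢ B).filter (fun e => e ∈ Y) := by
    ext e
    simp only [Finset.mem_filter, Finset.mem_product]
    tauto
  rw [h1, Finset.card_filter, Finset.sum_product]
  simp only [Finset.card_filter]

/-- The degree of column `j` is at most its degree into the row set `A` plus `#Aᶜ`
(every neighbour of `j` is in `A` or in `Aᶜ`). [folklore] -/
theorem colDeg_le_colDegIn_add_card_compl {n : ℕ} (Y : Finset (Fin n × Fin n))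
    (A : Finset (Fin n)) (j : Fin n) :
    (Finset.univ.filter fun i : Fin n => (i, j) ∈ Y).card ≤
      (A.filter fun i => (i, j) ∈ Y).card + Aᶜ.card := by
  calc (Finset.univ.filter fun i : Fin n => (i, j) ∈ Y).card
      ≤ ((A.filter fun i => (i, j) ∈ Y) ∪ Aᶜ).card := by
        apply Finset.card_le_card
        intro i hi
        simp only [Finset.mem_filter, Finset.mem_univ, true_and] at hi
        by_cases hiA : i ∈ A
        · exact Finset.mem_union_left _ (Finset.mem_filter.mpr ⟨hiA, hi⟩)
        · exact Finset.mem_union_right _ (Finset.mem_compl.mpr hiA)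
    _ ≤ _ := Finset.card_union_le _ _

/-- The degree of row `i` is at most its degree into the column set `B` plus `#Bᶜ`
(every neighbour of `i` is in `B` or in `Bᶜ`). [folklore] -/
theorem rowDeg_le_rowDegIn_add_card_compl {n : ℕ} (Y : Finset (Fin n × Fin n))
    (B : Finset (Fin n)) (i : Fin n) :
    (Finset.univ.filter fun j : Fin n => (i, j) ∈ Y).card ≤
      (B.filter fun j => (i, j) ∈ Y).card + Bᶜ.card := by
  calc (Finset.univ.filter fun j : Fin n => (i, j) ∈ Y).card
      ≤ ((B.filter fun j => (i, j) ∈ Y) ∪ Bᶜ).card := by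
        apply Finset.card_le_card
        intro j hj
        simp only [Finset.mem_filter, Finset.mem_univ, true_and] at hj
        by_cases hjB : j ∈ B
        · exact Finset.mem_union_left _ (Finset.mem_filter.mpr ⟨hjB, hj⟩)
        · exact Finset.mem_union_right _ (Finset.mem_compl.mpr hjB)
    _ ≤ _ := Finset.card_union_le _ _

/-- The real-arithmetic core of the cut condition.  With `θ ≥ 0`, `β θ² = ε`, `0 ≤ f ≤ (β − η − θ) n`,
`0 ≤ a, b ≤ n < a + b`, and the three lower bounds `e ≥ b ((β − η) n − (n − a))`,
`e ≥ a ((β − η) n − (n − b))`, `e ≥ β a b − ε n²`, one has `f (a + b − n) ≤ e`: if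
`(1 − θ) n < a` use the first bound (`(β − η) n − (n − a) > f`, `b ≥ a + b − n`), if
`(1 − θ) n < b` the second, and otherwise `(n − a)(n − b) ≥ θ² n²` turns the third into
`e ≥ β n (a + b − n) ≥ f (a + b − n)`. [folklore] -/
theorem cut_of_three_bounds {β ε η θ n a b f e : ℝ} (hβ : 0 < β) (hη : 0 ≤ η) (hθ0 : 0 ≤ θ)
    (hθ2 : β * θ ^ 2 = ε) (hf0 : 0 ≤ f) (hf : f ≤ (β - η - θ) * n)
    (hn0 : 0 ≤ n) (ha0 : 0 ≤ a) (hb0 : 0 ≤ b) (han : a ≤ n) (hbn : b ≤ n) (hs : n < a + b)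
    (he1 : b * ((β - η) * n - (n - a)) ≤ e) (he2 : a * ((β - η) * n - (n - b)) ≤ e)
    (he3 : β * a * b - ε * n ^ 2 ≤ e) :
    f * (a + b - n) ≤ e := by
  by_cases hA : (1 - θ) * n < a
  · -- (i) many rows: every column of `B` has more than `f` neighbours inside `A`
    have hX : f ≤ (β - η) * n - (n - a) := by linarith
    have h1 : b * f ≤ b * ((β - η) * n - (n - a)) := mul_le_mul_of_nonneg_left hX hb0
    have h2 : f * (a + b - n) ≤ b * f := by nlinarith [mul_nonneg hf0 (sub_nonneg.mpr han)]
    linarith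
  by_cases hB : (1 - θ) * n < b
  · -- (ii) many columns: symmetric
    have hX : f ≤ (β - η) * n - (n - b) := by linarith
    have h1 : a * f ≤ a * ((β - η) * n - (n - b)) := mul_le_mul_of_nonneg_left hX ha0
    have h2 : f * (a + b - n) ≤ a * f := by nlinarith [mul_nonneg hf0 (sub_nonneg.mpr hbn)]
    linarith
  -- (iii) both sides leave out at least `θ n` vertices: use the mixing bound
  push Not at hA hB
  have hna : θ * n ≤ n - a := by linarith
  have hnb : θ * n ≤ n - b := by linarith
  have hθn : 0 ≤ θ * n := mul_nonneg hθ0 hn0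
  have hprod : θ * n * (θ * n) ≤ (n - a) * (n - b) := mul_le_mul hna hnb hθn (hθn.trans hna)
  have h3 : β * (θ * n * (θ * n)) ≤ β * ((n - a) * (n - b)) :=
    mul_le_mul_of_nonneg_left hprod hβ.le
  have h4 : β * (θ * n * (θ * n)) = ε * n ^ 2 := by rw [← hθ2]; ring
  have hfn : f ≤ β * n := by nlinarith [mul_nonneg hη hn0, mul_nonneg hθ0 hn0]
  have h5 : f * (a + b - n) ≤ β * n * (a + b - n) :=
    mul_le_mul_of_nonneg_right hfn (by linarith)
  have h6 : β * n * (a + b - n) = β * a * b - β * ((n - a) * (n - b)) := by ring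
  linarith

/-- **stub_regularPairFactor — two-sided mixing and minimum degree give the `f`-factor cut
condition.**  Let `Y ⊆ Fin n × Fin n` (rows × columns) satisfy the lower mixing bound
`β #A #B − ε n² ≤ e_Y(A, B)` for all row sets `A` and column sets `B`, and have all row and
column degrees at least `(β − η) n` (`0 < β`, `0 ≤ ε`, `0 ≤ η`).  Then for every natural
`f ≤ (β − η − √(ε/β)) n` the cut condition of the bipartite `f`-factor theorem holds:
`f (#A + #B) ≤ f n + e_Y(A, B)` for all `A, B`.  Proof: `cut_of_three_bounds` fed with the
column count `e ≥ #B ((β − η) n − #Aᶜ)`, the row count `e ≥ #A ((β − η) n − #Bᶜ)` and the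
mixing bound. [folklore] -/
theorem stub_regularPairFactor :
    ∀ (n f : ℕ) (Y : Finset (Fin n × Fin n)) (β ε η : ℝ), 0 < β → 0 ≤ ε → 0 ≤ η →
      (∀ A B : Finset (Fin n),
        β * A.card * B.card - ε * (n : ℝ) ^ 2 ≤ ((Y.filter fun e => e.1 ∈ A ∧ e.2 ∈ B).card : ℝ)) →
      (∀ i : Fin n, (β - η) * n ≤ ((Finset.univ.filter fun j : Fin n => (i, j) ∈ Y).card : ℝ)) →
      (∀ j : Fin n, (β - η) * n ≤ ((Finset.univ.filter fun i : Fin n => (i, j) ∈ Y).card : ℝ)) →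
      (f : ℝ) ≤ (β - η - Real.sqrt (ε / β)) * n →
      ∀ A B : Finset (Fin n), f * (A.card + B.card) ≤ f * n + (Y.filter fun e => e.1 ∈ A ∧ e.2 ∈ B).card := by
  intro n f Y β ε η hβ hε hη hmix hrow hcol hf A B
  -- the trivial case `#A + #B ≤ n`
  by_cases hs : A.card + B.card ≤ n
  · calc f * (A.card + B.card) ≤ f * n := Nat.mul_le_mul_left f hs
      _ ≤ f * n + _ := Nat.le_add_right _ _
  push Not at hs
  have hAn : A.card ≤ n := by simpa using A.card_le_univ
  have hBn : B.card ≤ n := by simpa using B.card_le_univ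
  -- sizes of the complements, in `ℝ`
  have hAc : ((Aᶜ.card : ℕ) : ℝ) = (n : ℝ) - (A.card : ℝ) := by
    have h := Finset.card_compl_add_card A
    rw [Fintype.card_fin] at h
    have h' : ((Aᶜ.card : ℕ) : ℝ) + (A.card : ℝ) = (n : ℝ) := by exact_mod_cast h
    linarith
  have hBc : ((Bᶜ.card : ℕ) : ℝ) = (n : ℝ) - (B.card : ℝ) := by
    have h := Finset.card_compl_add_card B
    rw [Fintype.card_fin] at h
    have h' : ((Bᶜ.card : ℕ) : ℝ) + (B.card : ℝ) = (n : ℝ) := by exact_mod_cast h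
    linarith
  -- (1) column count: `e ≥ #B ((β − η) n − (n − #A))`
  have he1 : (B.card : ℝ) * ((β - η) * n - (n - A.card)) ≤
      ((Y.filter fun e => e.1 ∈ A ∧ e.2 ∈ B).card : ℝ) := by
    have hj : ∀ j ∈ B, (β - η) * n - (n - A.card) ≤ ((A.filter fun i => (i, j) ∈ Y).card : ℝ) := by
      intro j _
      have h1 := hcol j
      have h2 : ((Finset.univ.filter fun i : Fin n => (i, j) ∈ Y).card : ℝ) ≤
          ((A.filter fun i => (i, j) ∈ Y).card : ℝ) + ((Aᶜ.card : ℕ) : ℝ) := by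
        exact_mod_cast colDeg_le_colDegIn_add_card_compl Y A j
      linarith
    have hsum := Finset.sum_le_sum hj
    rw [Finset.sum_const, nsmul_eq_mul] at hsum
    rw [card_filter_rect_eq_sum_cols Y A B]
    push_cast
    exact hsum
  -- (2) row count: `e ≥ #A ((β − η) n − (n − #B))`
  have he2 : (A.card : ℝ) * ((β - η) * n - (n - B.card)) ≤
      ((Y.filter fun e => e.1 ∈ A ∧ e.2 ∈ B).card : ℝ) := by
    have hi : ∀ i ∈ A, (β - η) * n - (n - B.card) ≤ ((B.filter fun j => (i, j) ∈ Y).card : ℝ) := by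
      intro i _
      have h1 := hrow i
      have h2 : ((Finset.univ.filter fun j : Fin n => (i, j) ∈ Y).card : ℝ) ≤
          ((B.filter fun j => (i, j) ∈ Y).card : ℝ) + ((Bᶜ.card : ℕ) : ℝ) := by
        exact_mod_cast rowDeg_le_rowDegIn_add_card_compl Y B i
      linarith
    have hsum := Finset.sum_le_sum hi
    rw [Finset.sum_const, nsmul_eq_mul] at hsum
    rw [card_filter_rect_eq_sum_rows Y A B]
    push_cast
    exact hsum
  -- (3) mixing, and the arithmetic core
  have key : (f : ℝ) * ((A.card : ℝ) + B.card - n) ≤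
      ((Y.filter fun e => e.1 ∈ A ∧ e.2 ∈ B).card : ℝ) :=
    cut_of_three_bounds hβ hη (Real.sqrt_nonneg _)
      (by rw [Real.sq_sqrt (div_nonneg hε hβ.le)]; field_simp)
      (Nat.cast_nonneg f) hf (Nat.cast_nonneg n) (Nat.cast_nonneg _) (Nat.cast_nonneg _)
      (by exact_mod_cast hAn) (by exact_mod_cast hBn) (by exact_mod_cast hs) he1 he2 (hmix A B)
  have h : ((f * (A.card + B.card) : ℕ) : ℝ) ≤
      ((f * n + (Y.filter fun e => e.1 ∈ A ∧ e.2 ∈ B).card : ℕ) : ℝ) := by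
    push_cast
    linarith
  exact_mod_cast h

/-- **Corollary — quasi-random bipartite hosts have `f`-factors.**  Under the hypotheses of
`stub_regularPairFactor` (lower mixing bound `β #A #B − ε n² ≤ e_Y(A, B)`, minimum row/column
degree `(β − η) n`, `f ≤ (β − η − √(ε/β)) n`), the host `Y` has an `f`-regular spanning subgraph
`Y' ⊆ Y`: exactly `f` cells in every row and every column.  `stub_regularPairFactor` followed by
the bipartite `f`-factor theorem
`Literature.Combinatorics.Optimization.exists_regular_subgraph_of_cut_condition` (Ore 1956).
[folklore] -/
theorem exists_regularFactor_of_mixing (n f : ℕ) (Y : Finset (Fin n × Fin n)) (β ε η : ℝ)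
    (hβ : 0 < β) (hε : 0 ≤ ε) (hη : 0 ≤ η)
    (hmix : ∀ A B : Finset (Fin n),
      β * A.card * B.card - ε * (n : ℝ) ^ 2 ≤ ((Y.filter fun e => e.1 ∈ A ∧ e.2 ∈ B).card : ℝ))
    (hrow : ∀ i : Fin n, (β - η) * n ≤ ((Finset.univ.filter fun j : Fin n => (i, j) ∈ Y).card : ℝ))
    (hcol : ∀ j : Fin n, (β - η) * n ≤ ((Finset.univ.filter fun i : Fin n => (i, j) ∈ Y).card : ℝ))
    (hf : (f : ℝ) ≤ (β - η - Real.sqrt (ε / β)) * n) :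
    ∃ Y' : Finset (Fin n × Fin n), Y' ⊆ Y ∧
      (∀ i : Fin n, (Finset.univ.filter fun j : Fin n => (i, j) ∈ Y').card = f) ∧
      (∀ j : Fin n, (Finset.univ.filter fun i : Fin n => (i, j) ∈ Y').card = f) :=
  Literature.Combinatorics.Optimization.exists_regular_subgraph_of_cut_condition n f Y
    (stub_regularPairFactor n f Y β ε η hβ hε hη hmix hrow hcol hf)

end Summit.ValiantsHypothesis.ValiantsHypothesis.Theorems.DivisionGap.PerMultiplesHard.RegularPairFactor

end
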